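import Summits.ValiantsHypothesis.ValiantsHypothesis.Theorems.BarrierLeverChowThinRowsSubcube
import Summits.ValiantsHypothesis.ValiantsHypothesis.Theorems.BarrierLeverPartitionMinorsChowSwap

/-!
# Route BarrierLever — item `ChowHitsThinRowPartitionMinors` (stmt-ValiantsHypothesis-20195):
# the transposed slice — rows from a small down-closed family × FIRST-ORDER columns, every height

Helper file (`--supports stmt-ValiantsHypothesis-20195`; cell valiant-natproofs, rung V4, 𝒟-side of
door (c); prover seat valiant-natproofs-prover gen 10).  Closes NO item; imports only
`…ChowThinRowsSubcube` (this seat) and val-np-p4's `…PartitionMinorsChowSwap` (no route file).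

By the `x ↔ y` swap for Chow witnesses (`ChowFactor.chow_hit_swap`: a product of affine forms stays
one, the partition matrix is transposed) the master theorem
`ChowSubcube.chowHits_firstOrderRows_of_downClosed` yields its mirror image:

* `chowHits_downClosedRows_firstOrderColumns` — for every height `h`, every down-closed family `𝒟`
  of at most `h + h` subsets, injective ROWS `u i ∈ 𝒟` (any sizes) and injective COLUMNS of size
  `≤ 1`: ONE product of `h + h` affine forms makes the partition minor nonsingular.  For item 20195
  (rows of size `≤ 2`) this covers every down-closed thin row family — a graph on the `x`-variables
  together with its vertices and `∅`, e.g. ALL thin subsets of a set `A` with `1 + |A| + C(|A|,2) ≤ 2h`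
  — against first-order column families;
* `chowHits_thinRowsOfSet_firstOrderColumns` — the instance rows `⊆ Thin(A)`... stated as: rows any
  injective family of subsets of size `≤ 2` of a set `A` with `1 + |A| + |A|(|A|-1)/2 ≤ h + h`
  (down-closure inside `Thin(A)`), columns of size `≤ 1`.

WHAT THIS IS NOT: the capacity-critical `s = 2` family (rows `Thin(A)` × CUBE columns `2^T`) is not
covered (it needs the pair layer on down-closed columns, memo THINROWS-MEMO-g10 §8, Conjecture DC);
nothing on items 20172 / 19717 in general, on crux stmt-ValiantsHypothesis-14610, or on `VP` vs `VNP`.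
-/

set_option linter.dupNamespace false

namespace Summit.ValiantsHypothesis.ValiantsHypothesis.Theorems.BarrierLever.ChowSubcube

open Finset MvPolynomial

variable {h : ℕ}

/-- **Down-closed rows × first-order columns, every height**: the `x ↔ y` mirror of
`chowHits_firstOrderRows_of_downClosed`. -/
theorem chowHits_downClosedRows_firstOrderColumns (h : ℕ) (DD : Finset (Finset (Fin h)))
    (hDD : ∀ W ∈ DD, ∀ U : Finset (Fin h), U ⊆ W → U ∈ DD) (hcard : DD.card ≤ h + h)
    (r : ℕ) (u w : Fin r → Finset (Fin h))
    (hu : Function.Injective u) (hw : Function.Injective w)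
    (huD : ∀ i, u i ∈ DD) (hw1 : ∀ j, (w j).card ≤ 1) :
    ∃ ℓ : Fin (h + h) → MvPolynomial (Fin (h + h)) ℂ, (∀ k, (ℓ k).totalDegree ≤ 1) ∧
      (Matrix.of fun i j : Fin r => MvPolynomial.coeff
        (∑ a ∈ u i, Finsupp.single (Fin.castAdd h a) 1 +
          ∑ c ∈ w j, Finsupp.single (Fin.natAdd h c) 1) (∏ k, ℓ k)).det ≠ 0 :=
  ChowFactor.chow_hit_swap u w
    (chowHits_firstOrderRows_of_downClosed h DD hDD hcard r w u hw hu hw1 huD)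

/-- **Thin rows inside a set `A` × first-order columns, every height**: rows any injective family of
subsets of size `≤ 2` of a set `A` with `1 + |A| + |A|(|A|-1)/2 ≤ h + h` (e.g. ALL thin subsets of
`A`), columns injective of size `≤ 1`. -/
theorem chowHits_thinRowsOfSet_firstOrderColumns (h : ℕ) (A : Finset (Fin h))
    (hA : 1 + A.card + A.card * (A.card - 1) / 2 ≤ h + h)
    (r : ℕ) (u w : Fin r → Finset (Fin h))
    (hu : Function.Injective u) (hw : Function.Injective w)
    (hu2 : ∀ i, (u i).card ≤ 2) (huA : ∀ i, u i ⊆ A) (hw1 : ∀ j, (w j).card ≤ 1) :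
    ∃ ℓ : Fin (h + h) → MvPolynomial (Fin (h + h)) ℂ, (∀ k, (ℓ k).totalDegree ≤ 1) ∧
      (Matrix.of fun i j : Fin r => MvPolynomial.coeff
        (∑ a ∈ u i, Finsupp.single (Fin.castAdd h a) 1 +
          ∑ c ∈ w j, Finsupp.single (Fin.natAdd h c) 1) (∏ k, ℓ k)).det ≠ 0 := by
  classical
  -- the down-closed family of all subsets of `A` of size `≤ 2`
  refine chowHits_downClosedRows_firstOrderColumns h (A.powerset.filter fun S => S.card ≤ 2)
    ?_ ?_ r u w hu hw (fun i => Finset.mem_filter.mpr ⟨Finset.mem_powerset.mpr (huA i), hu2 i⟩) hw1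
  · intro W hW U hU
    rw [Finset.mem_filter, Finset.mem_powerset] at hW ⊢
    exact ⟨hU.trans hW.1, (Finset.card_le_card hU).trans hW.2⟩
  · -- `|{S ⊆ A : |S| ≤ 2}| = 1 + |A| + C(|A|, 2)`
    have hsplit : (A.powerset.filter fun S => S.card ≤ 2) =
        A.powersetCard 0 ∪ A.powersetCard 1 ∪ A.powersetCard 2 := by
      ext S
      simp only [Finset.mem_filter, Finset.mem_powerset, Finset.mem_union, Finset.mem_powersetCard]
      constructor
      · rintro ⟨hS, hc⟩
        rcases Nat.lt_or_ge S.card 1 with h0 | h1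
        · exact Or.inl (Or.inl ⟨hS, by omega⟩)
        · rcases Nat.lt_or_ge S.card 2 with h1' | h2
          · exact Or.inl (Or.inr ⟨hS, by omega⟩)
          · exact Or.inr ⟨hS, by omega⟩
      · rintro ((⟨hS, hc⟩ | ⟨hS, hc⟩) | ⟨hS, hc⟩) <;> exact ⟨hS, by omega⟩
    rw [hsplit]
    refine (Finset.card_union_le _ _).trans ?_
    refine (Nat.add_le_add_right (Finset.card_union_le _ _) _).trans ?_
    rw [Finset.card_powersetCard, Finset.card_powersetCard, Finset.card_powersetCard,
      Nat.choose_zero_right, Nat.choose_one_right, Nat.choose_two_right]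
    exact hA

end Summit.ValiantsHypothesis.ValiantsHypothesis.Theorems.BarrierLever.ChowSubcube
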